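import Summits.BirchSwinnertonDyer.BirchSwinnertonDyer.Theorems.ByReductionTypeAtTwoFineSelmerConjAAtTwoAdditivePotGoodTwoLayerDoorFukudaRows
import Summits.BirchSwinnertonDyer.BirchSwinnertonDyer.Theorems.ByReductionTypeAtTwoFineSelmerConjAAtTwoAdditivePotGoodClassNumberOne780
import HarnessLib

/-!
# Route `ByReductionTypeAtTwo` (rung K4), crux C1″ `FineSelmerConjAAtTwoAdditivePotGood` (item stmt-BirchSwinnertonDyer-22615):
# FUKUDA-ROW STAMPS, part F — census rows `121440bf1` (`d = -10120`), `460944bn1` (`d = -115236`), `200160bb1` (`d = -16680`) (EVEN class number of the cubic point field): (A)₂ modulo `hLim2` and ONE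
# displayed numeric equality (`ord₂ h(F(√2)) = ord₂ h(F)` resp. equal `2`-ranks), Fukuda's index `0` being KERNEL
# (a `--supports 22615` file; seat `bsd-2adic-k4-w1` GEN 5; consumers of `…TwoLayerDoorFukudaRows`)

HONEST FRAMING (cell `bsd-2adic`, D-0036/D-0054/D-0152): per-class stamps; conditional on `hLim2` (Lim 2017 Thm. 3.5 at `2`) BY NAME and on ONE
displayed numeric equality per row about the first two layers of the cyclotomic `ℤ₂`-tower of `ℚ(θ)` (census columns `cyc3/cyc6` of
`addL2x/gen5/conjA2_census_j289938_classes.tsv`, PARI — NOT kernel). These rows have EVEN `h(F)`, so neither Iwasawa 1956 nor the two-layer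
door with `e₀ = 0` applies; k4-w2 GEN 3's `bsdp_two_<L>_of_fukudaCertificate_pointField` displayed `hcert` = «`TotallyRamifiedFrom κL n₀` ∧
equal `2`-ranks» — the FIRST conjunct is now KERNEL (`n₀ = 0`: odd discriminant / one prime above `2` / even-index certificate), so the
row's (A)₂ hangs on ONE decidable class-group equality. KERNEL: irreducibility, `ℚ(P) = ℚ(θ)` (explicit change of generator), the
discharge of `n₀ = 0`, Fukuda Thm. 1 (`_holds`). Closes nothing at the `∀`-level; nothing booked; BSD is not proved by any of this.

THE FIELDS: `d = -10120`: `X³ + (-3)X² + (10)X + (10)`; `d = -115236`: `X³ + (-3)X² + (0)X + (-194)`; `d = -16680`: `X³ + (-2)X² + (-29)X + (-120)`.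

References: [Fukuda1994] Thm. 1 (1)(2); [Lim2017FineSelmer] Thm. 3.5, Lemma 3.2; [CoatesSujatha2005] (A); [Marcus1977] Ch. 2;
cell TSV `addL2x/gen5/conjA2_census_j289938_classes.tsv`.
-/

set_option autoImplicit false
-- sibling precedent (`…TwoLayerDoorFukudaRows.lean`): the directory name repeats the summit name
set_option linter.dupNamespace false

noncomputable section

open scoped Classical IntermediateField NumberField Real nonZeroDivisors

namespace Summit.BirchSwinnertonDyer.BirchSwinnertonDyer.Theorems.AddKatoTwo

open WeierstrassCurve Field Polynomial IsDedekindDomain NumberField Matrix Literature.NumberTheory.EllipticCurves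
  Literature.NumberTheory.GaloisRepresentations
  Literature.NumberTheory.IwasawaTheory
  Summit.BirchSwinnertonDyer.BirchSwinnertonDyer.Theorems.AlignedTransportAtTwoTorsionPointField
  Summit.BirchSwinnertonDyer.BirchSwinnertonDyer.Theses.ByReductionTypeAtTwo

/-! ## §1 Irreducibility of the models -/

/-- `X³ + (-3)X² + (10)X + (10)` (a model of the cubic field of discriminant `-10120`) is irreducible over `ℚ` (no root mod `7`). -/
theorem irreducible_cubic_d10120n : Irreducible (Cubic.toPoly ⟨1, ((-3 : ℤ) : ℚ), ((10 : ℤ) : ℚ), ((10 : ℤ) : ℚ)⟩) :=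
  haveI : Fact (Nat.Prime 7) := ⟨by norm_num⟩
  irreducible_cubic_of_no_root_zmod 7 (by decide)

/-- `X³ + (-3)X² + (0)X + (-194)` (a model of the cubic field of discriminant `-115236`) is irreducible over `ℚ` (no root mod `5`). -/
theorem irreducible_cubic_d115236n : Irreducible (Cubic.toPoly ⟨1, ((-3 : ℤ) : ℚ), ((0 : ℤ) : ℚ), ((-194 : ℤ) : ℚ)⟩) :=
  haveI : Fact (Nat.Prime 5) := ⟨by norm_num⟩
  irreducible_cubic_of_no_root_zmod 5 (by decide)

/-- `X³ + (-2)X² + (-29)X + (-120)` (a model of the cubic field of discriminant `-16680`) is irreducible over `ℚ` (no root mod `7`). -/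
theorem irreducible_cubic_d16680n : Irreducible (Cubic.toPoly ⟨1, ((-2 : ℤ) : ℚ), ((-29 : ℤ) : ℚ), ((-120 : ℤ) : ℚ)⟩) :=
  haveI : Fact (Nat.Prime 7) := ⟨by norm_num⟩
  irreducible_cubic_of_no_root_zmod 7 (by decide)

/-! ## §2 The stamps -/

/-- The census curve `121440bf1` is an elliptic curve. -/
theorem isElliptic_121440bf1' : (⟨0, ((-1 : ℤ) : ℚ), 0, ((-3251092416 : ℤ) : ℚ), ((-71348605585884 : ℤ) : ℚ)⟩ : WeierstrassCurve ℚ).IsElliptic :=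
  isElliptic_cubicModel _ _ _ (by simp only [Cubic.discr]; norm_num)

/-- **(A)₂ for `121440bf1` from Fukuda's two-layer criterion with `n₀ = 0` DISCHARGED — ONE displayed numeric equality** (a `C1″-RES` row
with EVEN `h(ℚ(P))`, `d = -10120`; k4-w2's `bsdp_two_121440bf1_of_fukudaCertificate_pointField` displayed the two-conjunct `hcert`). Granted
`hLim2`; displayed: `ord₂ h(ℚ(θ, √2)) = ord₂ h(ℚ(θ))` (census `cyc3 = [4]`, `cyc6 = [4]`), `θ` any root of `X³ + (-3)X² + (10)X + (10)`. KERNEL: `ℚ(P) = ℚ(β) = ℚ(θ)`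
(`β = 44696 + (-22670)θ + (6007)θ²` a root of the `2`-division cubic), Fukuda's index `0` from an EVEN-INDEX CERTIFICATE `u = [0, -1, -1]`, `v = [-1, 0, -1]` (`N(2 − m'³) = 4174952880273450`, `8 ∤`), Fukuda Thm. 1 (1) (`_holds`).
[cite: Lim2017FineSelmer, §3 Thm. 3.5 and Lemma 3.2] [cite: Fukuda1994, Thm. 1 (1), p. 264] -/
theorem conjA_two_121440bf1_of_fukudaLayers
    (hLim2 : Lim2017.thm35_at_two_fineSelmerDual_moduleFinite_of_classicalMuVanishes_of_le_divisionField_four)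
    {θ : AlgebraicClosure ℚ} (hθ : aeval θ (Cubic.toPoly ⟨1, ((-3 : ℤ) : ℚ), ((10 : ℤ) : ℚ), ((10 : ℤ) : ℚ)⟩) = 0)
    (h01 : haveI : FiniteDimensional ℚ (IntermediateField.adjoin ℚ {θ}) :=
        IntermediateField.adjoin.finiteDimensional ((AlgebraicClosure.isAlgebraic ℚ).isAlgebraic θ).isIntegral
      haveI : NumberField (IntermediateField.adjoin ℚ {θ}) := NumberField.mk
      ∀ κL : ZpExtension (IntermediateField.adjoin ℚ {θ}) 2, κL.IsCyclotomic → classNumberPExp κL 1 = classNumberPExp κL 0)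
    (κ : ZpExtension ℚ 2) (hκ : κ.IsCyclotomic) :
    haveI := isElliptic_121440bf1'
    ∃ (γ : absoluteGaloisGroup ℚ) (D : (⟨0, ((-1 : ℤ) : ℚ), 0, ((-3251092416 : ℤ) : ℚ), ((-71348605585884 : ℤ) : ℚ)⟩ : WeierstrassCurve ℚ).FineSelmerDualData κ γ),
      Module.Finite ℤ_[2] (RestrictScalars ℤ_[2] (IwasawaAlgebra 2) D.X) := by
  haveI := isElliptic_121440bf1'
  have hθ' : θ ^ 3 + (-3 : AlgebraicClosure ℚ) * θ ^ 2 + (10 : AlgebraicClosure ℚ) * θ + (10 : AlgebraicClosure ℚ) = 0 := by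
    have := hθ
    simp only [Cubic.toPoly, map_one, one_mul, aeval_add, aeval_mul, aeval_C, aeval_X_pow, aeval_X,
      eq_ratCast, Rat.cast_intCast] at this
    push_cast at this
    linear_combination this
  set β : AlgebraicClosure ℚ := algebraMap ℚ (AlgebraicClosure ℚ) (44696 : ℚ) +
      algebraMap ℚ (AlgebraicClosure ℚ) (-22670 : ℚ) * θ + algebraMap ℚ (AlgebraicClosure ℚ) (6007 : ℚ) * θ ^ 2 with hβdef
  have hβ : aeval β (Cubic.toPoly ⟨1, ((-1 : ℤ) : ℚ), ((-3251092416 : ℤ) : ℚ), ((-71348605585884 : ℤ) : ℚ)⟩) = 0 := by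
    simp only [Cubic.toPoly, map_one, one_mul, aeval_add, aeval_mul, aeval_C, aeval_X_pow, aeval_X, eq_ratCast,
      Rat.cast_intCast]
    rw [hβdef]
    simp only [eq_ratCast]
    push_cast
    linear_combination ((-12737078187830 : AlgebraicClosure ℚ) + (6520929185350 : AlgebraicClosure ℚ) * θ + (-1803805525461 : AlgebraicClosure ℚ) * θ ^ 2 + (216756882343 : AlgebraicClosure ℚ) * θ ^ 3) * hθ'
  have hadj : IntermediateField.adjoin ℚ {β} = IntermediateField.adjoin ℚ {θ} := by
    apply le_antisymm
    · rw [IntermediateField.adjoin_simple_le_iff, hβdef]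
      have hθmem := IntermediateField.mem_adjoin_simple_self ℚ θ
      exact add_mem (add_mem (algebraMap_mem _ _) (mul_mem (algebraMap_mem _ _) hθmem))
        (mul_mem (algebraMap_mem _ _) (pow_mem hθmem 2))
    · rw [IntermediateField.adjoin_simple_le_iff]
      have hθeq : θ = algebraMap ℚ (AlgebraicClosure ℚ) (197265539887/759375 : ℚ) +
          algebraMap ℚ (AlgebraicClosure ℚ) (39550091/10023750 : ℚ) * β +
          algebraMap ℚ (AlgebraicClosure ℚ) (-6007/50118750 : ℚ) * β ^ 2 := by
        rw [hβdef]; simp only [eq_ratCast]; push_cast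
        linear_combination (((-985780134631 : AlgebraicClosure ℚ) / 50118750) + ((216756882343 : AlgebraicClosure ℚ) / 50118750) * θ) * hθ'
      rw [hθeq]
      have hβmem := IntermediateField.mem_adjoin_simple_self ℚ β
      exact add_mem (add_mem (algebraMap_mem _ _) (mul_mem (algebraMap_mem _ _) hβmem))
        (mul_mem (algebraMap_mem _ _) (pow_mem hβmem 2))
  obtain ⟨P₀, hP₀, hP₀eq⟩ := exists_geomTorsion_two_eq_some_root ((-1 : ℤ) : ℚ) ((-3251092416 : ℤ) : ℚ)
    ((-71348605585884 : ℤ) : ℚ) hβ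
  have hF : IntermediateField.fixedField (MulAction.stabilizer (absoluteGaloisGroup ℚ) P₀) =
      IntermediateField.adjoin ℚ {θ} := by
    rw [fixedField_stabilizer_eq_adjoin_root _ _ _ hβ hP₀eq, ← hadj]
    -- the two `Algebra ℚ ℚ̄` instance paths agree
    congr 1
  have hirr := irreducible_cubic_d10120n
  haveI : FiniteDimensional ℚ (IntermediateField.adjoin ℚ {θ}) :=
    IntermediateField.adjoin.finiteDimensional ((AlgebraicClosure.isAlgebraic ℚ).isAlgebraic θ).isIntegral
  haveI : NumberField (IntermediateField.adjoin ℚ {θ}) := NumberField.mk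
  obtain ⟨B, -, hB⟩ := exists_ringOfIntegers_cubic_root (p := -3) (q := 10) (r := 10) hθ
  have h3 := finrank_adjoin_eq_three_of_irreducible hirr hθ
  have hz : (2 : 𝓞 (IntermediateField.adjoin ℚ {θ})) - (((-63 : ℤ) : 𝓞 (IntermediateField.adjoin ℚ {θ})) + ((-60 : ℤ) : 𝓞 (IntermediateField.adjoin ℚ {θ})) * B + ((29 : ℤ) : 𝓞 (IntermediateField.adjoin ℚ {θ})) * B ^ 2) ^ 3 =
      ((321309 : ℤ) : 𝓞 (IntermediateField.adjoin ℚ {θ})) + (-2457100 : ℤ) * B + (-3711191 : ℤ) * B ^ 2 := by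
    push_cast; linear_combination (((-7126 : ℤ) : 𝓞 (IntermediateField.adjoin ℚ {θ})) + ((324278 : ℤ) : 𝓞 (IntermediateField.adjoin ℚ {θ})) * B + ((78213 : ℤ) : 𝓞 (IntermediateField.adjoin ℚ {θ})) * B ^ 2 + ((-24389 : ℤ) : 𝓞 (IntermediateField.adjoin ℚ {θ})) * B ^ 3) * hB
  have hN : ¬ (8 : ℤ) ∣ Algebra.norm ℤ ((2 : 𝓞 (IntermediateField.adjoin ℚ {θ})) - (((-63 : ℤ) : 𝓞 (IntermediateField.adjoin ℚ {θ})) + ((-60 : ℤ) : 𝓞 (IntermediateField.adjoin ℚ {θ})) * B + ((29 : ℤ) : 𝓞 (IntermediateField.adjoin ℚ {θ})) * B ^ 2) ^ 3) := by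
    rw [hz]
    exact not_eight_dvd_norm_coords _ h3 B hirr hB (321309) (-2457100) (-3711191) (N := 4174952880273450)
      (by simp only [Matrix.one_fin_three, Matrix.det_fin_three, Matrix.add_apply, Matrix.smul_apply, sq, Matrix.mul_apply,
        Fin.sum_univ_three, Matrix.of_apply, Matrix.cons_val', Matrix.cons_val_zero, Matrix.cons_val_one, Matrix.cons_val_two,
        Matrix.head_cons, Matrix.tail_cons, Matrix.empty_val', Matrix.cons_val_fin_one, smul_eq_mul]; norm_num) (by norm_num)
  exact fineSelmerDual_moduleFinite_two_of_totallyRamified_of_succ_eq_pointField hLim2 _ hP₀ hF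
    (forall_totallyRamifiedFrom_zero_adjoin_of_evenIndexCertificate (p := -3) (q := 10) (r := 10) hirr hθ
      (((0 : ℤ) : 𝓞 (IntermediateField.adjoin ℚ {θ})) + ((-1 : ℤ) : 𝓞 (IntermediateField.adjoin ℚ {θ})) * B + ((-1 : ℤ) : 𝓞 (IntermediateField.adjoin ℚ {θ})) * B ^ 2) (((-1 : ℤ) : 𝓞 (IntermediateField.adjoin ℚ {θ})) + ((0 : ℤ) : 𝓞 (IntermediateField.adjoin ℚ {θ})) * B + ((-1 : ℤ) : 𝓞 (IntermediateField.adjoin ℚ {θ})) * B ^ 2) (((2 : ℤ) : 𝓞 (IntermediateField.adjoin ℚ {θ})) + ((5 : ℤ) : 𝓞 (IntermediateField.adjoin ℚ {θ})) * B + ((1 : ℤ) : 𝓞 (IntermediateField.adjoin ℚ {θ})) * B ^ 2) (((-63 : ℤ) : 𝓞 (IntermediateField.adjoin ℚ {θ})) + ((-60 : ℤ) : 𝓞 (IntermediateField.adjoin ℚ {θ})) * B + ((29 : ℤ) : 𝓞 (IntermediateField.adjoin ℚ {θ})) * B ^ 2)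
      (by push_cast; linear_combination (((-1 : ℤ) : 𝓞 (IntermediateField.adjoin ℚ {θ})) + ((-1 : ℤ) : 𝓞 (IntermediateField.adjoin ℚ {θ})) * B) * hB) (by push_cast; linear_combination (((13 : ℤ) : 𝓞 (IntermediateField.adjoin ℚ {θ})) + ((1 : ℤ) : 𝓞 (IntermediateField.adjoin ℚ {θ})) * B) * hB) hN)
    h01 κ hκ

/-- The census curve `460944bn1` is an elliptic curve. -/
theorem isElliptic_460944bn1' : (⟨0, ((0 : ℤ) : ℚ), 0, ((-5770251 : ℤ) : ℚ), ((-5454740502 : ℤ) : ℚ)⟩ : WeierstrassCurve ℚ).IsElliptic :=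
  isElliptic_cubicModel _ _ _ (by simp only [Cubic.discr]; norm_num)

/-- **(A)₂ for `460944bn1` from Fukuda's two-layer criterion with `n₀ = 0` DISCHARGED — ONE displayed numeric equality** (a `C1″-RES` row
with EVEN `h(ℚ(P))`, `d = -115236`; k4-w2's `bsdp_two_460944bn1_of_fukudaCertificate_pointField` displayed the two-conjunct `hcert`). Granted
`hLim2`; displayed: `ord₂ h(ℚ(θ, √2)) = ord₂ h(ℚ(θ))` (census `cyc3 = [2]`, `cyc6 = [2]`), `θ` any root of `X³ + (-3)X² + (0)X + (-194)`. KERNEL: `ℚ(P) = ℚ(β) = ℚ(θ)`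
(`β = -293 + (182)θ + (37)θ²` a root of the `2`-division cubic), Fukuda's index `0` from an EVEN-INDEX CERTIFICATE `u = [-2, -2, 0]`, `v = [0, -1, -1]` (`N(2 − m'³) = -110665217694897703746619984033104565923629875678`, `8 ∤`), Fukuda Thm. 1 (1) (`_holds`).
[cite: Lim2017FineSelmer, §3 Thm. 3.5 and Lemma 3.2] [cite: Fukuda1994, Thm. 1 (1), p. 264] -/
theorem conjA_two_460944bn1_of_fukudaLayers
    (hLim2 : Lim2017.thm35_at_two_fineSelmerDual_moduleFinite_of_classicalMuVanishes_of_le_divisionField_four)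
    {θ : AlgebraicClosure ℚ} (hθ : aeval θ (Cubic.toPoly ⟨1, ((-3 : ℤ) : ℚ), ((0 : ℤ) : ℚ), ((-194 : ℤ) : ℚ)⟩) = 0)
    (h01 : haveI : FiniteDimensional ℚ (IntermediateField.adjoin ℚ {θ}) :=
        IntermediateField.adjoin.finiteDimensional ((AlgebraicClosure.isAlgebraic ℚ).isAlgebraic θ).isIntegral
      haveI : NumberField (IntermediateField.adjoin ℚ {θ}) := NumberField.mk
      ∀ κL : ZpExtension (IntermediateField.adjoin ℚ {θ}) 2, κL.IsCyclotomic → classNumberPExp κL 1 = classNumberPExp κL 0)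
    (κ : ZpExtension ℚ 2) (hκ : κ.IsCyclotomic) :
    haveI := isElliptic_460944bn1'
    ∃ (γ : absoluteGaloisGroup ℚ) (D : (⟨0, ((0 : ℤ) : ℚ), 0, ((-5770251 : ℤ) : ℚ), ((-5454740502 : ℤ) : ℚ)⟩ : WeierstrassCurve ℚ).FineSelmerDualData κ γ),
      Module.Finite ℤ_[2] (RestrictScalars ℤ_[2] (IwasawaAlgebra 2) D.X) := by
  haveI := isElliptic_460944bn1'
  have hθ' : θ ^ 3 + (-3 : AlgebraicClosure ℚ) * θ ^ 2 + (0 : AlgebraicClosure ℚ) * θ + (-194 : AlgebraicClosure ℚ) = 0 := by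
    have := hθ
    simp only [Cubic.toPoly, map_one, one_mul, aeval_add, aeval_mul, aeval_C, aeval_X_pow, aeval_X,
      eq_ratCast, Rat.cast_intCast] at this
    push_cast at this
    linear_combination this
  set β : AlgebraicClosure ℚ := algebraMap ℚ (AlgebraicClosure ℚ) (-293 : ℚ) +
      algebraMap ℚ (AlgebraicClosure ℚ) (182 : ℚ) * θ + algebraMap ℚ (AlgebraicClosure ℚ) (37 : ℚ) * θ ^ 2 with hβdef
  have hβ : aeval β (Cubic.toPoly ⟨1, ((0 : ℤ) : ℚ), ((-5770251 : ℤ) : ℚ), ((-5454740502 : ℤ) : ℚ)⟩) = 0 := by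
    simp only [Cubic.toPoly, map_one, one_mul, aeval_add, aeval_mul, aeval_C, aeval_X_pow, aeval_X, eq_ratCast,
      Rat.cast_intCast]
    rw [hβdef]
    simp only [eq_ratCast]
    push_cast
    linear_combination ((19532014 : AlgebraicClosure ℚ) + (5171712 : AlgebraicClosure ℚ) * θ + (899433 : AlgebraicClosure ℚ) * θ ^ 2 + (50653 : AlgebraicClosure ℚ) * θ ^ 3) * hθ'
  have hadj : IntermediateField.adjoin ℚ {β} = IntermediateField.adjoin ℚ {θ} := by
    apply le_antisymm
    · rw [IntermediateField.adjoin_simple_le_iff, hβdef]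
      have hθmem := IntermediateField.mem_adjoin_simple_self ℚ θ
      exact add_mem (add_mem (algebraMap_mem _ _) (mul_mem (algebraMap_mem _ _) hθmem))
        (mul_mem (algebraMap_mem _ _) (pow_mem hθmem 2))
    · rw [IntermediateField.adjoin_simple_le_iff]
      have hθeq : θ = algebraMap ℚ (AlgebraicClosure ℚ) (8229483/322102 : ℚ) +
          algebraMap ℚ (AlgebraicClosure ℚ) (21389/1932612 : ℚ) * β +
          algebraMap ℚ (AlgebraicClosure ℚ) (-37/5797836 : ℚ) * β ^ 2 := by
        rw [hβdef]; simp only [eq_ratCast]; push_cast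
        linear_combination (((650275 : AlgebraicClosure ℚ) / 5797836) + ((50653 : AlgebraicClosure ℚ) / 5797836) * θ) * hθ'
      rw [hθeq]
      have hβmem := IntermediateField.mem_adjoin_simple_self ℚ β
      exact add_mem (add_mem (algebraMap_mem _ _) (mul_mem (algebraMap_mem _ _) hβmem))
        (mul_mem (algebraMap_mem _ _) (pow_mem hβmem 2))
  obtain ⟨P₀, hP₀, hP₀eq⟩ := exists_geomTorsion_two_eq_some_root ((0 : ℤ) : ℚ) ((-5770251 : ℤ) : ℚ)
    ((-5454740502 : ℤ) : ℚ) hβ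
  have hF : IntermediateField.fixedField (MulAction.stabilizer (absoluteGaloisGroup ℚ) P₀) =
      IntermediateField.adjoin ℚ {θ} := by
    rw [fixedField_stabilizer_eq_adjoin_root _ _ _ hβ hP₀eq, ← hadj]
    -- the two `Algebra ℚ ℚ̄` instance paths agree
    congr 1
  have hirr := irreducible_cubic_d115236n
  haveI : FiniteDimensional ℚ (IntermediateField.adjoin ℚ {θ}) :=
    IntermediateField.adjoin.finiteDimensional ((AlgebraicClosure.isAlgebraic ℚ).isAlgebraic θ).isIntegral
  haveI : NumberField (IntermediateField.adjoin ℚ {θ}) := NumberField.mk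
  obtain ⟨B, -, hB⟩ := exists_ringOfIntegers_cubic_root (p := -3) (q := 0) (r := -194) hθ
  have h3 := finrank_adjoin_eq_three_of_irreducible hirr hθ
  have hz : (2 : 𝓞 (IntermediateField.adjoin ℚ {θ})) - (((260397 : ℤ) : 𝓞 (IntermediateField.adjoin ℚ {θ})) + ((50733 : ℤ) : 𝓞 (IntermediateField.adjoin ℚ {θ})) * B + ((10116 : ℤ) : 𝓞 (IntermediateField.adjoin ℚ {θ})) * B ^ 2) ^ 3 =
      ((-362109567300581077 : ℤ) : 𝓞 (IntermediateField.adjoin ℚ {θ})) + (-51854484649185207 : ℤ) * B + (-13019093978830686 : ℤ) * B ^ 2 := by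
    push_cast; linear_combination (((-1775530580943249 : ℤ) : 𝓞 (IntermediateField.adjoin ℚ {θ})) + ((-214094785049964 : ℤ) : 𝓞 (IntermediateField.adjoin ℚ {θ})) * B + ((-18680665392432 : ℤ) : 𝓞 (IntermediateField.adjoin ℚ {θ})) * B ^ 2 + ((-1035205240896 : ℤ) : 𝓞 (IntermediateField.adjoin ℚ {θ})) * B ^ 3) * hB
  have hN : ¬ (8 : ℤ) ∣ Algebra.norm ℤ ((2 : 𝓞 (IntermediateField.adjoin ℚ {θ})) - (((260397 : ℤ) : 𝓞 (IntermediateField.adjoin ℚ {θ})) + ((50733 : ℤ) : 𝓞 (IntermediateField.adjoin ℚ {θ})) * B + ((10116 : ℤ) : 𝓞 (IntermediateField.adjoin ℚ {θ})) * B ^ 2) ^ 3) := by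
    rw [hz]
    exact not_eight_dvd_norm_coords _ h3 B hirr hB (-362109567300581077) (-51854484649185207) (-13019093978830686) (N := -110665217694897703746619984033104565923629875678)
      (by simp only [Matrix.one_fin_three, Matrix.det_fin_three, Matrix.add_apply, Matrix.smul_apply, sq, Matrix.mul_apply,
        Fin.sum_univ_three, Matrix.of_apply, Matrix.cons_val', Matrix.cons_val_zero, Matrix.cons_val_one, Matrix.cons_val_two,
        Matrix.head_cons, Matrix.tail_cons, Matrix.empty_val', Matrix.cons_val_fin_one, smul_eq_mul]; norm_num) (by norm_num)
  exact fineSelmerDual_moduleFinite_two_of_totallyRamified_of_succ_eq_pointField hLim2 _ hP₀ hF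
    (forall_totallyRamifiedFrom_zero_adjoin_of_evenIndexCertificate (p := -3) (q := 0) (r := -194) hirr hθ
      (((-2 : ℤ) : 𝓞 (IntermediateField.adjoin ℚ {θ})) + ((-2 : ℤ) : 𝓞 (IntermediateField.adjoin ℚ {θ})) * B + ((0 : ℤ) : 𝓞 (IntermediateField.adjoin ℚ {θ})) * B ^ 2) (((0 : ℤ) : 𝓞 (IntermediateField.adjoin ℚ {θ})) + ((-1 : ℤ) : 𝓞 (IntermediateField.adjoin ℚ {θ})) * B + ((-1 : ℤ) : 𝓞 (IntermediateField.adjoin ℚ {θ})) * B ^ 2) (((-484 : ℤ) : 𝓞 (IntermediateField.adjoin ℚ {θ})) + ((-95 : ℤ) : 𝓞 (IntermediateField.adjoin ℚ {θ})) * B + ((-7 : ℤ) : 𝓞 (IntermediateField.adjoin ℚ {θ})) * B ^ 2) (((260397 : ℤ) : 𝓞 (IntermediateField.adjoin ℚ {θ})) + ((50733 : ℤ) : 𝓞 (IntermediateField.adjoin ℚ {θ})) * B + ((10116 : ℤ) : 𝓞 (IntermediateField.adjoin ℚ {θ})) * B ^ 2)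
      (by push_cast; linear_combination (((-10 : ℤ) : 𝓞 (IntermediateField.adjoin ℚ {θ})) + ((-2 : ℤ) : 𝓞 (IntermediateField.adjoin ℚ {θ})) * B) * hB) (by push_cast; linear_combination (((1477 : ℤ) : 𝓞 (IntermediateField.adjoin ℚ {θ})) + ((49 : ℤ) : 𝓞 (IntermediateField.adjoin ℚ {θ})) * B) * hB) hN)
    h01 κ hκ

/-- The census curve `200160bb1` is an elliptic curve. -/
theorem isElliptic_200160bb1' : (⟨0, ((0 : ℤ) : ℚ), 0, ((-1046032063923 : ℤ) : ℚ), ((411780464906411878 : ℤ) : ℚ)⟩ : WeierstrassCurve ℚ).IsElliptic :=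
  isElliptic_cubicModel _ _ _ (by simp only [Cubic.discr]; norm_num)

/-- **(A)₂ for `200160bb1` from Fukuda's two-layer criterion with `n₀ = 0` DISCHARGED — ONE displayed numeric equality** (a `C1″-RES` row
with EVEN `h(ℚ(P))`, `d = -16680`; k4-w2's `bsdp_two_200160bb1_of_fukudaCertificate_pointField` displayed the two-conjunct `hcert`). Granted
`hLim2`; displayed: `rank₂ Cl(ℚ(θ, √2)) = rank₂ Cl(ℚ(θ))` (census `cyc3 = [2]`, `cyc6 = [4]`), `θ` any root of `X³ + (-2)X² + (-29)X + (-120)`. KERNEL: `ℚ(P) = ℚ(β) = ℚ(θ)`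
(`β = 361562 + (-84876)θ + (-14757)θ²` a root of the `2`-division cubic), Fukuda's index `0` from an EVEN-INDEX CERTIFICATE `u = [0, -1, -1]`, `v = [0, -1, 0]` (`N(2 − m'³) = -255853312694546481414473091513903198`, `8 ∤`), Fukuda Thm. 1 (2) (`_holds`).
[cite: Lim2017FineSelmer, §3 Thm. 3.5 and Lemma 3.2] [cite: Fukuda1994, Thm. 1 (2), p. 264] -/
theorem conjA_two_200160bb1_of_fukudaLayers
    (hLim2 : Lim2017.thm35_at_two_fineSelmerDual_moduleFinite_of_classicalMuVanishes_of_le_divisionField_four)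
    {θ : AlgebraicClosure ℚ} (hθ : aeval θ (Cubic.toPoly ⟨1, ((-2 : ℤ) : ℚ), ((-29 : ℤ) : ℚ), ((-120 : ℤ) : ℚ)⟩) = 0)
    (h01 : haveI : FiniteDimensional ℚ (IntermediateField.adjoin ℚ {θ}) :=
        IntermediateField.adjoin.finiteDimensional ((AlgebraicClosure.isAlgebraic ℚ).isAlgebraic θ).isIntegral
      haveI : NumberField (IntermediateField.adjoin ℚ {θ}) := NumberField.mk
      ∀ κL : ZpExtension (IntermediateField.adjoin ℚ {θ}) 2, κL.IsCyclotomic → classGroupPRank κL 1 = classGroupPRank κL 0)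
    (κ : ZpExtension ℚ 2) (hκ : κ.IsCyclotomic) :
    haveI := isElliptic_200160bb1'
    ∃ (γ : absoluteGaloisGroup ℚ) (D : (⟨0, ((0 : ℤ) : ℚ), 0, ((-1046032063923 : ℤ) : ℚ), ((411780464906411878 : ℤ) : ℚ)⟩ : WeierstrassCurve ℚ).FineSelmerDualData κ γ),
      Module.Finite ℤ_[2] (RestrictScalars ℤ_[2] (IwasawaAlgebra 2) D.X) := by
  haveI := isElliptic_200160bb1'
  have hθ' : θ ^ 3 + (-2 : AlgebraicClosure ℚ) * θ ^ 2 + (-29 : AlgebraicClosure ℚ) * θ + (-120 : AlgebraicClosure ℚ) = 0 := by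
    have := hθ
    simp only [Cubic.toPoly, map_one, one_mul, aeval_add, aeval_mul, aeval_C, aeval_X_pow, aeval_X,
      eq_ratCast, Rat.cast_intCast] at this
    push_cast at this
    linear_combination this
  set β : AlgebraicClosure ℚ := algebraMap ℚ (AlgebraicClosure ℚ) (361562 : ℚ) +
      algebraMap ℚ (AlgebraicClosure ℚ) (-84876 : ℚ) * θ + algebraMap ℚ (AlgebraicClosure ℚ) (-14757 : ℚ) * θ ^ 2 with hβdef
  have hβ : aeval β (Cubic.toPoly ⟨1, ((0 : ℤ) : ℚ), ((-1046032063923 : ℤ) : ℚ), ((411780464906411878 : ℤ) : ℚ)⟩) = 0 := by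
    simp only [Cubic.toPoly, map_one, one_mul, aeval_add, aeval_mul, aeval_C, aeval_X_pow, aeval_X, eq_ratCast,
      Rat.cast_intCast]
    rw [hβdef]
    simp only [eq_ratCast]
    push_cast
    linear_combination ((-673674702107004 : AlgebraicClosure ℚ) + (-299663968415895 : AlgebraicClosure ℚ) * θ + (-61877333120958 : AlgebraicClosure ℚ) * θ ^ 2 + (-3213617856093 : AlgebraicClosure ℚ) * θ ^ 3) * hθ'
  have hadj : IntermediateField.adjoin ℚ {β} = IntermediateField.adjoin ℚ {θ} := by
    apply le_antisymm
    · rw [IntermediateField.adjoin_simple_le_iff, hβdef]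
      have hθmem := IntermediateField.mem_adjoin_simple_self ℚ θ
      exact add_mem (add_mem (algebraMap_mem _ _) (mul_mem (algebraMap_mem _ _) hθmem))
        (mul_mem (algebraMap_mem _ _) (pow_mem hθmem 2))
    · rw [IntermediateField.adjoin_simple_le_iff]
      have hθeq : θ = algebraMap ℚ (AlgebraicClosure ℚ) (1715429128911329/427832148375 : ℚ) +
          algebraMap ℚ (AlgebraicClosure ℚ) (-2909744551/855664296750 : ℚ) * β +
          algebraMap ℚ (AlgebraicClosure ℚ) (-4919/855664296750 : ℚ) * β ^ 2 := by
        rw [hβdef]; simp only [eq_ratCast]; push_cast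
        linear_combination (((803591987371 : AlgebraicClosure ℚ) / 47536905375) + ((119022883559 : AlgebraicClosure ℚ) / 95073810750) * θ) * hθ'
      rw [hθeq]
      have hβmem := IntermediateField.mem_adjoin_simple_self ℚ β
      exact add_mem (add_mem (algebraMap_mem _ _) (mul_mem (algebraMap_mem _ _) hβmem))
        (mul_mem (algebraMap_mem _ _) (pow_mem hβmem 2))
  obtain ⟨P₀, hP₀, hP₀eq⟩ := exists_geomTorsion_two_eq_some_root ((0 : ℤ) : ℚ) ((-1046032063923 : ℤ) : ℚ)
    ((411780464906411878 : ℤ) : ℚ) hβ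
  have hF : IntermediateField.fixedField (MulAction.stabilizer (absoluteGaloisGroup ℚ) P₀) =
      IntermediateField.adjoin ℚ {θ} := by
    rw [fixedField_stabilizer_eq_adjoin_root _ _ _ hβ hP₀eq, ← hadj]
    -- the two `Algebra ℚ ℚ̄` instance paths agree
    congr 1
  have hirr := irreducible_cubic_d16680n
  haveI : FiniteDimensional ℚ (IntermediateField.adjoin ℚ {θ}) :=
    IntermediateField.adjoin.finiteDimensional ((AlgebraicClosure.isAlgebraic ℚ).isAlgebraic θ).isIntegral
  haveI : NumberField (IntermediateField.adjoin ℚ {θ}) := NumberField.mk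
  obtain ⟨B, -, hB⟩ := exists_ringOfIntegers_cubic_root (p := -2) (q := -29) (r := -120) hθ
  have h3 := finrank_adjoin_eq_three_of_irreducible hirr hθ
  have hz : (2 : 𝓞 (IntermediateField.adjoin ℚ {θ})) - (((80640 : ℤ) : 𝓞 (IntermediateField.adjoin ℚ {θ})) + ((29688 : ℤ) : 𝓞 (IntermediateField.adjoin ℚ {θ})) * B + ((5219 : ℤ) : 𝓞 (IntermediateField.adjoin ℚ {θ})) * B ^ 2) ^ 3 =
      ((-31322721666628318 : ℤ) : 𝓞 (IntermediateField.adjoin ℚ {θ})) + (-11613947827985404 : ℤ) * B + (-2021601237788599 : ℤ) * B ^ 2 := by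
    push_cast; linear_combination (((-256652792504036 : ℤ) : 𝓞 (IntermediateField.adjoin ℚ {θ})) + ((-29932088426283 : ℤ) : 𝓞 (IntermediateField.adjoin ℚ {θ})) * B + ((-2710231595422 : ℤ) : 𝓞 (IntermediateField.adjoin ℚ {θ})) * B ^ 2 + ((-142154918459 : ℤ) : 𝓞 (IntermediateField.adjoin ℚ {θ})) * B ^ 3) * hB
  have hN : ¬ (8 : ℤ) ∣ Algebra.norm ℤ ((2 : 𝓞 (IntermediateField.adjoin ℚ {θ})) - (((80640 : ℤ) : 𝓞 (IntermediateField.adjoin ℚ {θ})) + ((29688 : ℤ) : 𝓞 (IntermediateField.adjoin ℚ {θ})) * B + ((5219 : ℤ) : 𝓞 (IntermediateField.adjoin ℚ {θ})) * B ^ 2) ^ 3) := by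
    rw [hz]
    exact not_eight_dvd_norm_coords _ h3 B hirr hB (-31322721666628318) (-11613947827985404) (-2021601237788599) (N := -255853312694546481414473091513903198)
      (by simp only [Matrix.one_fin_three, Matrix.det_fin_three, Matrix.add_apply, Matrix.smul_apply, sq, Matrix.mul_apply,
        Fin.sum_univ_three, Matrix.of_apply, Matrix.cons_val', Matrix.cons_val_zero, Matrix.cons_val_one, Matrix.cons_val_two,
        Matrix.head_cons, Matrix.tail_cons, Matrix.empty_val', Matrix.cons_val_fin_one, smul_eq_mul]; norm_num) (by norm_num)
  exact fineSelmerDual_moduleFinite_two_of_totallyRamified_of_rank_succ_eq_pointField hLim2 _ hP₀ hF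
    (forall_totallyRamifiedFrom_zero_adjoin_of_evenIndexCertificate (p := -2) (q := -29) (r := -120) hirr hθ
      (((0 : ℤ) : 𝓞 (IntermediateField.adjoin ℚ {θ})) + ((-1 : ℤ) : 𝓞 (IntermediateField.adjoin ℚ {θ})) * B + ((-1 : ℤ) : 𝓞 (IntermediateField.adjoin ℚ {θ})) * B ^ 2) (((0 : ℤ) : 𝓞 (IntermediateField.adjoin ℚ {θ})) + ((-1 : ℤ) : 𝓞 (IntermediateField.adjoin ℚ {θ})) * B + ((0 : ℤ) : 𝓞 (IntermediateField.adjoin ℚ {θ})) * B ^ 2) (((120 : ℤ) : 𝓞 (IntermediateField.adjoin ℚ {θ})) + ((59 : ℤ) : 𝓞 (IntermediateField.adjoin ℚ {θ})) * B + ((9 : ℤ) : 𝓞 (IntermediateField.adjoin ℚ {θ})) * B ^ 2) (((80640 : ℤ) : 𝓞 (IntermediateField.adjoin ℚ {θ})) + ((29688 : ℤ) : 𝓞 (IntermediateField.adjoin ℚ {θ})) * B + ((5219 : ℤ) : 𝓞 (IntermediateField.adjoin ℚ {θ})) * B ^ 2)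
      (by push_cast; linear_combination (((4 : ℤ) : 𝓞 (IntermediateField.adjoin ℚ {θ})) + ((1 : ℤ) : 𝓞 (IntermediateField.adjoin ℚ {θ})) * B) * hB) (by push_cast; linear_combination (((1224 : ℤ) : 𝓞 (IntermediateField.adjoin ℚ {θ})) + ((81 : ℤ) : 𝓞 (IntermediateField.adjoin ℚ {θ})) * B) * hB) hN)
    h01 κ hκ

end Summit.BirchSwinnertonDyer.BirchSwinnertonDyer.Theorems.AddKatoTwo

end
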